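import Summits.HodgeConjecture.HodgeCM.PerL34.PrintedOrbitEndState_1

/-! PORT of `HodgeCM/PerL34/PrintedOrbitEndState.lean` (HodgeCMPerL run 82) — part 2: continuation of `Summits.HodgeConjecture.HodgeCM.PerL34.PrintedOrbitEndState_1` (split at a top-level declaration boundary by port_pkg.py; scope re-opened below; declarations unchanged). -/

-- port_pkg: scope re-opened for this part (file-level context, then the namespace/section stack open at the cut)
set_option autoImplicit false
noncomputable section
open MeasureTheory
namespace HodgeCM
namespace Universe
namespace AdelicTorusCore
open HodgeCM.PerL34 HodgeCM.PerL34.ArchC HodgeCM.PerL34.Fock HodgeCM.PerL34.Fock.PrintDict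
open HodgeCM.Prior.Perl34File HodgeCM.Prior.Perl34File.Perl34
open NumberField NumberField.SeesawArchTorus
variable {U : Universe} {hP : PrintFact_unitaryCompact} (C : U.AdelicTorusCore hP)
  (R12 : ∀ {L : CMField} {ι₁ : L →+* ℂ} (V : HermSpace3 L ι₁) (c : SeesawCtx L), C.Rest12 V c)
  (R34 : ∀ {L : CMField} {ι₁ : L →+* ℂ} (V : HermSpace3 L ι₁) (c : SeesawCtx L), C.Rest34 V c)
  (hA : (C.rtc R12 R34).Analytic)
section OpenOcc
namespace OpOrbitCore34
variable {C R12 R34 hA} {L : CMField} {ι₁ : L →+* ℂ} {V : HermSpace3 L ι₁} {c : SeesawCtx L}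
/-- Node #3's (34) operator-side printed core gives this one. -/
def ofOp (B : OpPrintedCore34 C R12 R34 hA V c) : OpOrbitCore34 C R12 R34 hA V c :=
  letI := B.decEq
  { decEq := B.decEq
    kind := B.kind
    lam := B.lam
    hlam := B.hlam
    side := B.side.toOrbit }

end OpOrbitCore34

/-- **`Open_occ` (N29 = PerL Lemma 4.1(c) / Thm 3.7 (†), BOTH torus sides) of the END-STATE theta model from D7-free
OPERATOR-SIDE printed data**: per good context one `OpOrbitCore12` and one `OpOrbitCore34` (eleven fields each plus
kind and scalings).  No hypothesis mentions a structure on `𝒮^κ`, smooth vectors of `σ̂_i`, the torus side, the points,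
N21 or a continuity of `Φ ↦ 𝒯_Φ`. -/
theorem Open_occ_of_opOrbitCores
    (A12 : ∀ {L : CMField} {ι₁ : L →+* ℂ} (V : HermSpace3 L ι₁) (c : SeesawCtx L),
      (ThetaModel.ofRegCarrier (C.rtc R12 R34) hA).GoodCtx ι₁ c → Nonempty (C.OpOrbitCore12 R12 R34 hA V c))
    (A34 : ∀ {L : CMField} {ι₁ : L →+* ℂ} (V : HermSpace3 L ι₁) (c : SeesawCtx L),
      (ThetaModel.ofRegCarrier (C.rtc R12 R34) hA).GoodCtx ι₁ c → Nonempty (C.OpOrbitCore34 R12 R34 hA V c)) :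
    (ThetaModel.ofRegCarrier (C.rtc R12 R34) hA).Open_occ :=
  fun V c hc => ⟨fun Φ i h => (A12 V c hc).elim fun A => A.H_occ Φ i h,
    fun Φ i h => (A34 V c hc).elim fun A => A.H_occ Φ i h⟩

/-- **N29 BY THE CARVER'S NAME** (`Arch.N29_occ`) on the end state, from the D7-free operator-side cores. -/
theorem N29_occ_of_opOrbitCores
    (A12 : ∀ {L : CMField} {ι₁ : L →+* ℂ} (V : HermSpace3 L ι₁) (c : SeesawCtx L),
      (ThetaModel.ofRegCarrier (C.rtc R12 R34) hA).GoodCtx ι₁ c → Nonempty (C.OpOrbitCore12 R12 R34 hA V c))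
    (A34 : ∀ {L : CMField} {ι₁ : L →+* ℂ} (V : HermSpace3 L ι₁) (c : SeesawCtx L),
      (ThetaModel.ofRegCarrier (C.rtc R12 R34) hA).GoodCtx ι₁ c → Nonempty (C.OpOrbitCore34 R12 R34 hA V c)) :
    N29_occ (ThetaModel.ofRegCarrier (C.rtc R12 R34) hA) :=
  C.Open_occ_of_opOrbitCores R12 R34 hA A12 A34

/-- Node #3's `Open_occ_of_opPrintedCores` FACTORS through the D7-free cores (`ofOp`). -/
theorem Open_occ_of_opPrintedCores_viaOrbit
    (A12 : ∀ {L : CMField} {ι₁ : L →+* ℂ} (V : HermSpace3 L ι₁) (c : SeesawCtx L),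
      (ThetaModel.ofRegCarrier (C.rtc R12 R34) hA).GoodCtx ι₁ c → Nonempty (C.OpPrintedCore12 R12 R34 hA V c))
    (A34 : ∀ {L : CMField} {ι₁ : L →+* ℂ} (V : HermSpace3 L ι₁) (c : SeesawCtx L),
      (ThetaModel.ofRegCarrier (C.rtc R12 R34) hA).GoodCtx ι₁ c → Nonempty (C.OpPrintedCore34 R12 R34 hA V c)) :
    (ThetaModel.ofRegCarrier (C.rtc R12 R34) hA).Open_occ :=
  C.Open_occ_of_opOrbitCores R12 R34 hA (fun V c hc => (A12 V c hc).map OpOrbitCore12.ofOp)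
    (fun V c hc => (A34 V c hc).map OpOrbitCore34.ofOp)

/-- **The (12) D7-free LINEAR printed core of a context on the END STATE of a linear Weil theta model**: a kind map,
scalings, and a nine-field `LinOrbitSide` over `T∘.core V c` (for pv02-g7's structure on `𝒮^κ`, node #4's instances). -/
structure LinOrbitCore12 {L : CMField} {ι₁ : L →+* ℂ} (V : HermSpace3 L ι₁) (c : SeesawCtx L)
    [ℓ : (C.wm V c).LinearStr] where
  [decEq : DecidableEq (InfinitePlace (L : Type))]
  kind : InfinitePlace (L : Type) → PlaceKind
  lam : InfinitePlace (L : Type) → ℂ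
  hlam : ∀ w, lam w ≠ 0
  side : LinOrbitSide ((ThetaModel.ofRegCarrier (C.rtc R12 R34) hA).core V c) (C.pointedCore R12 R34 hA V c)
    (InfinitePlace (L : Type)) kind lam hlam (pinnedVacs kind (R12 V c).m₁ (R12 V c).m₂)
    (C.chart12 R12 V c kind lam hlam)

/-- **The (34) D7-free LINEAR printed core of a context on the END STATE of a linear Weil theta model.** -/
structure LinOrbitCore34 {L : CMField} {ι₁ : L →+* ℂ} (V : HermSpace3 L ι₁) (c : SeesawCtx L)
    [ℓ : (C.wm V c).LinearStr] where
  [decEq : DecidableEq (InfinitePlace (L : Type))]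
  kind : InfinitePlace (L : Type) → PlaceKind
  lam : InfinitePlace (L : Type) → ℂ
  hlam : ∀ w, lam w ≠ 0
  side : LinOrbitSide ((ThetaModel.ofRegCarrier (C.rtc R12 R34) hA).core V c) (C.pointedCore R12 R34 hA V c)
    (InfinitePlace (L : Type)) kind lam hlam (pinnedVacs kind (R34 V c).m₁ (R34 V c).m₂)
    (C.chart34 R34 V c kind lam hlam)

namespace LinOrbitCore12

variable {C R12 R34 hA} {L : CMField} {ι₁ : L →+* ℂ} {V : HermSpace3 L ι₁} {c : SeesawCtx L}

/-- The D7-free operator-side core from the linear one: linearity laws := node #4 `TΦc_add_of_linear` /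
`TΦc_smul_of_linear`, operator-norm continuity := node #3 `continuous_TΦc`. -/
def toOp [ℓ : (C.wm V c).LinearStr] (A : LinOrbitCore12 C R12 R34 hA V c) : OpOrbitCore12 C R12 R34 hA V c :=
  letI := A.decEq
  { decEq := A.decEq
    kind := A.kind
    lam := A.lam
    hlam := A.hlam
    side := A.side.toOp (C.TΦc_add_of_linear R12 R34 hA V c) (C.TΦc_smul_of_linear R12 R34 hA V c)
      (C.continuous_TΦc R12 R34 hA V c) }

/-- **Lemma 4.1(c), pair (12), on the END STATE of a linear Weil theta model from the nine-field linear core alone.** -/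
theorem H_occ [ℓ : (C.wm V c).LinearStr] (A : LinOrbitCore12 C R12 R34 hA V c) :
    ∀ (Φ : (ThetaModel.ofRegCarrier (C.rtc R12 R34) hA).SK V c)
      (i : (ThetaModel.ofRegCarrier (C.rtc R12 R34) hA).SigIdx V c),
      (∃ v ∈ ((ThetaModel.ofRegCarrier (C.rtc R12 R34) hA).core V c).hatσ i,
        ((ThetaModel.ofRegCarrier (C.rtc R12 R34) hA).core V c).TΦ Φ v ≠ 0) →
      ((ThetaModel.ofRegCarrier (C.rtc R12 R34) hA).t12 V c).wOccurs i :=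
  A.toOp.H_occ

/-- Node #4's linear printed core gives this one (forgetful `LinearSide.toLinOrbit`). -/
def ofLin [ℓ : (C.wm V c).LinearStr] (B : LinPrintedCore12 C R12 R34 hA V c) : LinOrbitCore12 C R12 R34 hA V c :=
  letI := B.decEq
  { decEq := B.decEq
    kind := B.kind
    lam := B.lam
    hlam := B.hlam
    side := B.side.toLinOrbit }

end LinOrbitCore12

namespace LinOrbitCore34

variable {C R12 R34 hA} {L : CMField} {ι₁ : L →+* ℂ} {V : HermSpace3 L ι₁} {c : SeesawCtx L}

/-- The (34) D7-free operator-side core from the linear one. -/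
def toOp [ℓ : (C.wm V c).LinearStr] (A : LinOrbitCore34 C R12 R34 hA V c) : OpOrbitCore34 C R12 R34 hA V c :=
  letI := A.decEq
  { decEq := A.decEq
    kind := A.kind
    lam := A.lam
    hlam := A.hlam
    side := A.side.toOp (C.TΦc_add_of_linear R12 R34 hA V c) (C.TΦc_smul_of_linear R12 R34 hA V c)
      (C.continuous_TΦc R12 R34 hA V c) }

/-- **Lemma 4.1(c), pair (34), on the END STATE of a linear Weil theta model from the nine-field linear core alone.** -/
theorem H_occ [ℓ : (C.wm V c).LinearStr] (A : LinOrbitCore34 C R12 R34 hA V c) :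
    ∀ (Φ : (ThetaModel.ofRegCarrier (C.rtc R12 R34) hA).SK V c)
      (i : (ThetaModel.ofRegCarrier (C.rtc R12 R34) hA).SigIdx V c),
      (∃ v ∈ ((ThetaModel.ofRegCarrier (C.rtc R12 R34) hA).core V c).hatσ i,
        ((ThetaModel.ofRegCarrier (C.rtc R12 R34) hA).core V c).TΦ Φ v ≠ 0) →
      ((ThetaModel.ofRegCarrier (C.rtc R12 R34) hA).t34 V c).wOccurs i :=
  A.toOp.H_occ

/-- Node #4's (34) linear printed core gives this one. -/
def ofLin [ℓ : (C.wm V c).LinearStr] (B : LinPrintedCore34 C R12 R34 hA V c) : LinOrbitCore34 C R12 R34 hA V c :=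
  letI := B.decEq
  { decEq := B.decEq
    kind := B.kind
    lam := B.lam
    hlam := B.hlam
    side := B.side.toLinOrbit }

end LinOrbitCore34

/-- **`Open_occ` (N29, BOTH torus sides) of the END-STATE theta model of a core with LINEAR Weil theta models, from
nine-field D7-free linear printed data per good context and pair.** -/
theorem Open_occ_of_linOrbitCores
    (lin : ∀ {L : CMField} {ι₁ : L →+* ℂ} (V : HermSpace3 L ι₁) (c : SeesawCtx L), (C.wm V c).LinearStr)
    (A12 : ∀ {L : CMField} {ι₁ : L →+* ℂ} (V : HermSpace3 L ι₁) (c : SeesawCtx L),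
      (ThetaModel.ofRegCarrier (C.rtc R12 R34) hA).GoodCtx ι₁ c →
        Nonempty (C.LinOrbitCore12 R12 R34 hA V c (ℓ := lin V c)))
    (A34 : ∀ {L : CMField} {ι₁ : L →+* ℂ} (V : HermSpace3 L ι₁) (c : SeesawCtx L),
      (ThetaModel.ofRegCarrier (C.rtc R12 R34) hA).GoodCtx ι₁ c →
        Nonempty (C.LinOrbitCore34 R12 R34 hA V c (ℓ := lin V c))) :
    (ThetaModel.ofRegCarrier (C.rtc R12 R34) hA).Open_occ :=
  fun V c hc => ⟨fun Φ i h => (A12 V c hc).elim fun A => A.H_occ (ℓ := lin V c) Φ i h,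
    fun Φ i h => (A34 V c hc).elim fun A => A.H_occ (ℓ := lin V c) Φ i h⟩

/-- **N29 BY THE CARVER'S NAME** on the end state of a core with linear Weil theta models, D7-free linear cores. -/
theorem N29_occ_of_linOrbitCores
    (lin : ∀ {L : CMField} {ι₁ : L →+* ℂ} (V : HermSpace3 L ι₁) (c : SeesawCtx L), (C.wm V c).LinearStr)
    (A12 : ∀ {L : CMField} {ι₁ : L →+* ℂ} (V : HermSpace3 L ι₁) (c : SeesawCtx L),
      (ThetaModel.ofRegCarrier (C.rtc R12 R34) hA).GoodCtx ι₁ c →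
        Nonempty (C.LinOrbitCore12 R12 R34 hA V c (ℓ := lin V c)))
    (A34 : ∀ {L : CMField} {ι₁ : L →+* ℂ} (V : HermSpace3 L ι₁) (c : SeesawCtx L),
      (ThetaModel.ofRegCarrier (C.rtc R12 R34) hA).GoodCtx ι₁ c →
        Nonempty (C.LinOrbitCore34 R12 R34 hA V c (ℓ := lin V c))) :
    N29_occ (ThetaModel.ofRegCarrier (C.rtc R12 R34) hA) :=
  C.Open_occ_of_linOrbitCores R12 R34 hA lin A12 A34

end OpenOcc

end AdelicTorusCore

/-! ## §3  The same for the sign-recipe end state `C₀.thetaModel h d12 d34` (prl1-g5) -/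

namespace AdelicThetaCore

open HodgeCM.PerL34

variable {U : Universe} {hP : PrintFact_unitaryCompact} (C₀ : U.AdelicThetaCore hP) (h : Bool)
  (d12 d34 : ∀ {L : CMField}, SeesawCtx L → SideData L)

/-- **`Open_occ` of prl1-g5's END-STATE model `C₀.thetaModel h d12 d34`** from the D7-free operator-side cores of its
contexts (by `rfl` on `Open_occ_of_opOrbitCores`). -/
theorem Open_occ_thetaModel_of_opOrbitCores
    (A12 : ∀ {L : CMField} {ι₁ : L →+* ℂ} (V : HermSpace3 L ι₁) (c : SeesawCtx L),
      (C₀.thetaModel h d12 d34).GoodCtx ι₁ c →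
        Nonempty ((C₀.toCore h).OpOrbitCore12 ((C₀.toCore h).side12 d12) ((C₀.toCore h).side34 d34)
          ((C₀.toCore h).analyticKM ((C₀.toCore h).side12 d12) ((C₀.toCore h).side34 d34)).toAnalytic V c))
    (A34 : ∀ {L : CMField} {ι₁ : L →+* ℂ} (V : HermSpace3 L ι₁) (c : SeesawCtx L),
      (C₀.thetaModel h d12 d34).GoodCtx ι₁ c →
        Nonempty ((C₀.toCore h).OpOrbitCore34 ((C₀.toCore h).side12 d12) ((C₀.toCore h).side34 d34)
          ((C₀.toCore h).analyticKM ((C₀.toCore h).side12 d12) ((C₀.toCore h).side34 d34)).toAnalytic V c)) :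
    (C₀.thetaModel h d12 d34).Open_occ :=
  (C₀.toCore h).Open_occ_of_opOrbitCores _ _ _ A12 A34

/-- **`Open_occ` of prl1-g5's END-STATE model with LINEAR Weil theta models** from the D7-free linear cores. -/
theorem Open_occ_thetaModel_of_linOrbitCores
    (lin : ∀ {L : CMField} {ι₁ : L →+* ℂ} (V : HermSpace3 L ι₁) (c : SeesawCtx L), ((C₀.toCore h).wm V c).LinearStr)
    (A12 : ∀ {L : CMField} {ι₁ : L →+* ℂ} (V : HermSpace3 L ι₁) (c : SeesawCtx L),
      (C₀.thetaModel h d12 d34).GoodCtx ι₁ c →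
        Nonempty ((C₀.toCore h).LinOrbitCore12 ((C₀.toCore h).side12 d12) ((C₀.toCore h).side34 d34)
          ((C₀.toCore h).analyticKM ((C₀.toCore h).side12 d12) ((C₀.toCore h).side34 d34)).toAnalytic V c
          (ℓ := lin V c)))
    (A34 : ∀ {L : CMField} {ι₁ : L →+* ℂ} (V : HermSpace3 L ι₁) (c : SeesawCtx L),
      (C₀.thetaModel h d12 d34).GoodCtx ι₁ c →
        Nonempty ((C₀.toCore h).LinOrbitCore34 ((C₀.toCore h).side12 d12) ((C₀.toCore h).side34 d34)
          ((C₀.toCore h).analyticKM ((C₀.toCore h).side12 d12) ((C₀.toCore h).side34 d34)).toAnalytic V c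
          (ℓ := lin V c))) :
    (C₀.thetaModel h d12 d34).Open_occ :=
  (C₀.toCore h).Open_occ_of_linOrbitCores _ _ _ lin A12 A34

end AdelicThetaCore

end Universe

/-! ## §4  The binder-minimal END STATES with `occ` from D7-free printed cores -/

namespace Assembly

open HodgeCM.PerL34
open HodgeCM.Prior.Perl34File HodgeCM.Prior.Perl34File.Perl34
open HodgeCM.Universe (AdelicThetaCore AdelicThetaCore₀ AdelicTorusCore SideData ThetaModel)

variable (U : Universe)

/-- **Both realisation inputs of part (a), binder-minimal END STATE, `occ` from D7-free operator-side cores.** -/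
theorem realisationExists_ofSignRecipe₀_opOrbitCores (M : U.ModelAxioms) (h : Bool) (C : U.AdelicThetaCore₀)
    (d12 d34 : ∀ {L : CMField}, SeesawCtx L → SideData L)
    (embCover : (C.thetaModel h d12 d34).Fact_embCover) (innerEmb : (C.thetaModel h d12 d34).Fact_innerEmb)
    (thetaSub : (C.thetaModel h d12 d34).Open_thetaSub) (thetaWedge : (C.thetaModel h d12 d34).Open_thetaWedge)
    (thetaGen12 : (C.thetaModel h d12 d34).Open_thetaGen12)
    (thetaReal34 : (C.thetaModel h d12 d34).Open_thetaReal34) (chars : (C.thetaModel h d12 d34).Open_chars)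
    (A12 : ∀ {L : CMField} {ι₁ : L →+* ℂ} (V : HermSpace3 L ι₁) (c : SeesawCtx L),
      (C.thetaModel h d12 d34).GoodCtx ι₁ c →
        Nonempty ((C.toCore h).OpOrbitCore12 ((C.toCore h).side12 d12) ((C.toCore h).side34 d34)
          ((C.toCore h).analyticKM ((C.toCore h).side12 d12) ((C.toCore h).side34 d34)).toAnalytic V c))
    (A34 : ∀ {L : CMField} {ι₁ : L →+* ℂ} (V : HermSpace3 L ι₁) (c : SeesawCtx L),
      (C.thetaModel h d12 d34).GoodCtx ι₁ c →
        Nonempty ((C.toCore h).OpOrbitCore34 ((C.toCore h).side12 d12) ((C.toCore h).side34 d34)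
          ((C.toCore h).analyticKM ((C.toCore h).side12 d12) ((C.toCore h).side34 d34)).toAnalytic V c))
    (hHR : U.Fact_hodgeRiemann20) : U.RealisationExistsPerL ∧ U.RealisationExistsFace :=
  realisationExists_ofSignRecipe₀ U M h C d12 d34
    ⟨embCover, innerEmb, thetaSub, thetaWedge, thetaGen12, thetaReal34, chars,
      C.Open_occ_thetaModel_of_opOrbitCores h d12 d34 A12 A34⟩ hHR

/-- **PerL, binder-minimal END STATE, `occ` from D7-free operator-side cores.** -/
theorem perL_ofSignRecipe₀_opOrbitCores (M : U.ModelAxioms) (h : Bool) (C : U.AdelicThetaCore₀)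
    (d12 d34 : ∀ {L : CMField}, SeesawCtx L → SideData L)
    (embCover : (C.thetaModel h d12 d34).Fact_embCover) (innerEmb : (C.thetaModel h d12 d34).Fact_innerEmb)
    (thetaSub : (C.thetaModel h d12 d34).Open_thetaSub) (thetaWedge : (C.thetaModel h d12 d34).Open_thetaWedge)
    (thetaGen12 : (C.thetaModel h d12 d34).Open_thetaGen12)
    (thetaReal34 : (C.thetaModel h d12 d34).Open_thetaReal34) (chars : (C.thetaModel h d12 d34).Open_chars)
    (A12 : ∀ {L : CMField} {ι₁ : L →+* ℂ} (V : HermSpace3 L ι₁) (c : SeesawCtx L),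
      (C.thetaModel h d12 d34).GoodCtx ι₁ c →
        Nonempty ((C.toCore h).OpOrbitCore12 ((C.toCore h).side12 d12) ((C.toCore h).side34 d34)
          ((C.toCore h).analyticKM ((C.toCore h).side12 d12) ((C.toCore h).side34 d34)).toAnalytic V c))
    (A34 : ∀ {L : CMField} {ι₁ : L →+* ℂ} (V : HermSpace3 L ι₁) (c : SeesawCtx L),
      (C.thetaModel h d12 d34).GoodCtx ι₁ c →
        Nonempty ((C.toCore h).OpOrbitCore34 ((C.toCore h).side12 d12) ((C.toCore h).side34 d34)
          ((C.toCore h).analyticKM ((C.toCore h).side12 d12) ((C.toCore h).side34 d34)).toAnalytic V c))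
    (hHR : U.Fact_hodgeRiemann20) : U.PerL :=
  perL_ofSignRecipe₀ U M h C d12 d34
    ⟨embCover, innerEmb, thetaSub, thetaWedge, thetaGen12, thetaReal34, chars,
      C.Open_occ_thetaModel_of_opOrbitCores h d12 d34 A12 A34⟩ hHR

/-- **COR-CM, binder-minimal END STATE, `occ` from D7-free operator-side cores.** -/
theorem COR_CM_endState_ofSignRecipe₀_opOrbitCores (M : U.ModelAxioms) (h29 : U.Fact_weightSpan)
    (h30 : U.Fact_weightHodge) (hE : U.Qw8ExtProd) (hD : U.Qw8DualPushPull) (hMi : U.Qw8Milne) (h : Bool)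
    (C : U.AdelicThetaCore₀) (d12 d34 : ∀ {L : CMField}, SeesawCtx L → SideData L)
    (embCover : (C.thetaModel h d12 d34).Fact_embCover) (innerEmb : (C.thetaModel h d12 d34).Fact_innerEmb)
    (thetaSub : (C.thetaModel h d12 d34).Open_thetaSub) (thetaWedge : (C.thetaModel h d12 d34).Open_thetaWedge)
    (thetaGen12 : (C.thetaModel h d12 d34).Open_thetaGen12)
    (thetaReal34 : (C.thetaModel h d12 d34).Open_thetaReal34) (chars : (C.thetaModel h d12 d34).Open_chars)
    (A12 : ∀ {L : CMField} {ι₁ : L →+* ℂ} (V : HermSpace3 L ι₁) (c : SeesawCtx L),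
      (C.thetaModel h d12 d34).GoodCtx ι₁ c →
        Nonempty ((C.toCore h).OpOrbitCore12 ((C.toCore h).side12 d12) ((C.toCore h).side34 d34)
          ((C.toCore h).analyticKM ((C.toCore h).side12 d12) ((C.toCore h).side34 d34)).toAnalytic V c))
    (A34 : ∀ {L : CMField} {ι₁ : L →+* ℂ} (V : HermSpace3 L ι₁) (c : SeesawCtx L),
      (C.thetaModel h d12 d34).GoodCtx ι₁ c →
        Nonempty ((C.toCore h).OpOrbitCore34 ((C.toCore h).side12 d12) ((C.toCore h).side34 d34)
          ((C.toCore h).analyticKM ((C.toCore h).side12 d12) ((C.toCore h).side34 d34)).toAnalytic V c))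
    (hHR : U.Fact_hodgeRiemann20) : U.HC_CM :=
  COR_CM_endState_ofSignRecipe₀ U M h29 h30 hE hD hMi h C d12 d34
    ⟨embCover, innerEmb, thetaSub, thetaWedge, thetaGen12, thetaReal34, chars,
      C.Open_occ_thetaModel_of_opOrbitCores h d12 d34 A12 A34⟩ hHR

/-- **PerL, binder-minimal END STATE with LINEAR Weil theta models, `occ` from D7-free nine-field linear cores.** -/
theorem perL_ofSignRecipe₀_linOrbitCores (M : U.ModelAxioms) (h : Bool) (C : U.AdelicThetaCore₀)
    (d12 d34 : ∀ {L : CMField}, SeesawCtx L → SideData L)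
    (lin : ∀ {L : CMField} {ι₁ : L →+* ℂ} (V : HermSpace3 L ι₁) (c : SeesawCtx L), ((C.toCore h).wm V c).LinearStr)
    (embCover : (C.thetaModel h d12 d34).Fact_embCover) (innerEmb : (C.thetaModel h d12 d34).Fact_innerEmb)
    (thetaSub : (C.thetaModel h d12 d34).Open_thetaSub) (thetaWedge : (C.thetaModel h d12 d34).Open_thetaWedge)
    (thetaGen12 : (C.thetaModel h d12 d34).Open_thetaGen12)
    (thetaReal34 : (C.thetaModel h d12 d34).Open_thetaReal34) (chars : (C.thetaModel h d12 d34).Open_chars)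
    (A12 : ∀ {L : CMField} {ι₁ : L →+* ℂ} (V : HermSpace3 L ι₁) (c : SeesawCtx L),
      (C.thetaModel h d12 d34).GoodCtx ι₁ c →
        Nonempty ((C.toCore h).LinOrbitCore12 ((C.toCore h).side12 d12) ((C.toCore h).side34 d34)
          ((C.toCore h).analyticKM ((C.toCore h).side12 d12) ((C.toCore h).side34 d34)).toAnalytic V c
          (ℓ := lin V c)))
    (A34 : ∀ {L : CMField} {ι₁ : L →+* ℂ} (V : HermSpace3 L ι₁) (c : SeesawCtx L),
      (C.thetaModel h d12 d34).GoodCtx ι₁ c →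
        Nonempty ((C.toCore h).LinOrbitCore34 ((C.toCore h).side12 d12) ((C.toCore h).side34 d34)
          ((C.toCore h).analyticKM ((C.toCore h).side12 d12) ((C.toCore h).side34 d34)).toAnalytic V c
          (ℓ := lin V c)))
    (hHR : U.Fact_hodgeRiemann20) : U.PerL :=
  perL_ofSignRecipe₀ U M h C d12 d34
    ⟨embCover, innerEmb, thetaSub, thetaWedge, thetaGen12, thetaReal34, chars,
      C.Open_occ_thetaModel_of_linOrbitCores h d12 d34 lin A12 A34⟩ hHR

/-- **COR-CM, binder-minimal END STATE with LINEAR Weil theta models, `occ` from D7-free nine-field linear cores.** -/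
theorem COR_CM_endState_ofSignRecipe₀_linOrbitCores (M : U.ModelAxioms) (h29 : U.Fact_weightSpan)
    (h30 : U.Fact_weightHodge) (hE : U.Qw8ExtProd) (hD : U.Qw8DualPushPull) (hMi : U.Qw8Milne) (h : Bool)
    (C : U.AdelicThetaCore₀) (d12 d34 : ∀ {L : CMField}, SeesawCtx L → SideData L)
    (lin : ∀ {L : CMField} {ι₁ : L →+* ℂ} (V : HermSpace3 L ι₁) (c : SeesawCtx L), ((C.toCore h).wm V c).LinearStr)
    (embCover : (C.thetaModel h d12 d34).Fact_embCover) (innerEmb : (C.thetaModel h d12 d34).Fact_innerEmb)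
    (thetaSub : (C.thetaModel h d12 d34).Open_thetaSub) (thetaWedge : (C.thetaModel h d12 d34).Open_thetaWedge)
    (thetaGen12 : (C.thetaModel h d12 d34).Open_thetaGen12)
    (thetaReal34 : (C.thetaModel h d12 d34).Open_thetaReal34) (chars : (C.thetaModel h d12 d34).Open_chars)
    (A12 : ∀ {L : CMField} {ι₁ : L →+* ℂ} (V : HermSpace3 L ι₁) (c : SeesawCtx L),
      (C.thetaModel h d12 d34).GoodCtx ι₁ c →
        Nonempty ((C.toCore h).LinOrbitCore12 ((C.toCore h).side12 d12) ((C.toCore h).side34 d34)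
          ((C.toCore h).analyticKM ((C.toCore h).side12 d12) ((C.toCore h).side34 d34)).toAnalytic V c
          (ℓ := lin V c)))
    (A34 : ∀ {L : CMField} {ι₁ : L →+* ℂ} (V : HermSpace3 L ι₁) (c : SeesawCtx L),
      (C.thetaModel h d12 d34).GoodCtx ι₁ c →
        Nonempty ((C.toCore h).LinOrbitCore34 ((C.toCore h).side12 d12) ((C.toCore h).side34 d34)
          ((C.toCore h).analyticKM ((C.toCore h).side12 d12) ((C.toCore h).side34 d34)).toAnalytic V c
          (ℓ := lin V c)))
    (hHR : U.Fact_hodgeRiemann20) : U.HC_CM :=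
  COR_CM_endState_ofSignRecipe₀ U M h29 h30 hE hD hMi h C d12 d34
    ⟨embCover, innerEmb, thetaSub, thetaWedge, thetaGen12, thetaReal34, chars,
      C.Open_occ_thetaModel_of_linOrbitCores h d12 d34 lin A12 A34⟩ hHR

end Assembly

end HodgeCM

end
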